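import Mathlib.Analysis.SpecialFunctions.Integrals.Basic
import Mathlib.Analysis.SpecialFunctions.Integrability.Basic
import Mathlib.Analysis.SpecialFunctions.Pow.Continuity
import Mathlib.Topology.Order.Compact
import HarnessLib

/-!
# The homogeneous weakly singular Grönwall inequality forces vanishing

Analysis/ODE support file (pure real analysis, everything proved; no definitions).  The uniqueness half
of Henry's singular Grönwall lemma (D. Henry, *Geometric Theory of Semilinear Parabolic Equations*,
LNM 840 (1981), Lemma 7.1.1, the case `a = 0`; used for the uniqueness of mild solutions in his
Thm. 3.3.3): if `d ≥ 0` is continuous on `[0, τ]`, `α < 1`, and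

  `d(t) ≤ M ∫₀ᵗ (t − s)^{−α} d(s) ds`  for `t ∈ [0, τ]`,

then `d ≡ 0` on `[0, τ]` (`eq_zero_of_le_mul_integral_rpow_neg_mul`).  Proof (elementary, no Mittag-Leffler
series): induction over the windows `[kδ, (k+1)δ]` with `M δ^{1−α}/(1−α) ≤ 1/2`; if `d = 0` on `[0, kδ]`, then
at a maximum point `t*` of `d` on the next window `d(t*) ≤ M d(t*) ∫_{kδ}^{t*} (t* − s)^{−α} ds ≤ d(t*)/2`.
Also recorded: the interval integrability of `s ↦ (t − s)^{−α} g(s)` for `g` continuous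
(`intervalIntegrable_sub_rpow_neg_mul`) and `∫_{a}^{t} (t − s)^{−α} ds = (t − a)^{1−α}/(1−α)`
(`integral_sub_rpow_neg`).

Mathlib has the differential Grönwall inequality (`Mathlib.Analysis.ODE.Gronwall`) only; the tree's
`Literature/Analysis/ODE/NonlinearFractionalGronwall.lean` and
`Literature/Analysis/FluidPDE/AncientLPSLiouvilleBootstrap.lean` prove inhomogeneous `ℝ≥0∞`-valued bootstrap
versions with the kernel `(t − s)^{−1/2}`; the present homogeneous real-valued statement for general `α < 1`
is what the uniqueness of mild solutions of semilinear parabolic equations consumes.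

## References

* D. Henry, *Geometric Theory of Semilinear Parabolic Equations*, LNM 840, Springer (1981), Lemma 7.1.1,
  Thm. 3.3.3. [Henry1981]
-/

noncomputable section

open Set Filter MeasureTheory intervalIntegral

namespace Literature.Analysis.ODE

/-- `∫ₐᵗ (t − s)^{−α} ds = (t − a)^{1−α} / (1 − α)` for `α < 1` (for `t < a` both sides carry the same
junk value of the real power of a negative base). [folklore] -/
theorem integral_sub_rpow_neg {α : ℝ} (hα : α < 1) (a t : ℝ) :
    ∫ s in a..t, (t - s) ^ (-α) = (t - a) ^ (1 - α) / (1 - α) := by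
  rw [intervalIntegral.integral_comp_sub_left (fun x : ℝ => x ^ (-α)) t, sub_self,
    integral_rpow (Or.inl (by linarith)), Real.zero_rpow (by linarith), sub_zero]
  congr 1 <;> ring_nf

/-- For `α < 1` and `g` continuous on `[a, b]`, the weakly singular integrand `s ↦ (t − s)^{−α} g(s)` is
interval integrable on `[a, b]`. [folklore] -/
theorem intervalIntegrable_sub_rpow_neg_mul {α a b : ℝ} (hα : α < 1) (t : ℝ) {g : ℝ → ℝ}
    (hg : ContinuousOn g (uIcc a b)) :
    IntervalIntegrable (fun s => (t - s) ^ (-α) * g s) volume a b := by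
  have h1 : IntervalIntegrable (fun s : ℝ => (t - s) ^ (-α)) volume a b := by
    have h := (intervalIntegral.intervalIntegrable_rpow' (a := t - a) (b := t - b) (r := -α)
      (by linarith)).comp_sub_left t
    simp only [sub_sub_cancel] at h
    exact h
  exact h1.mul_continuousOn hg

/-- **The homogeneous weakly singular Grönwall inequality forces vanishing** (Henry 1981, Lemma 7.1.1 with
`a = 0`).  If `d` is continuous and nonnegative on `[0, τ]`, `α < 1`, and
`d(t) ≤ M ∫₀ᵗ (t − s)^{−α} d(s) ds` for every `t ∈ [0, τ]`, then `d = 0` on `[0, τ]`.  (No sign condition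
on `M` is needed: the integral is nonnegative.)  Proof by induction over windows of length `δ` with
`max(M,1) δ^{1−α}/(1−α) = 1/2`, comparing `d` with its maximum on each window. [cite: Henry1981, Lemma 7.1.1] -/
theorem eq_zero_of_le_mul_integral_rpow_neg_mul {α M τ : ℝ} (hα : α < 1) {d : ℝ → ℝ}
    (hd : ContinuousOn d (Icc 0 τ)) (hd0 : ∀ t ∈ Icc 0 τ, 0 ≤ d t)
    (hle : ∀ t ∈ Icc 0 τ, d t ≤ M * ∫ s in (0 : ℝ)..t, (t - s) ^ (-α) * d s) :
    ∀ t ∈ Icc 0 τ, d t = 0 := by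
  have hα1 : 0 < 1 - α := by linarith
  -- a positive constant
  set M' : ℝ := max M 1 with hM'
  have hM'0 : 0 < M' := lt_of_lt_of_le zero_lt_one (le_max_right _ _)
  -- nonnegativity of the integral and the inequality with `M'`
  have hInonneg : ∀ t ∈ Icc 0 τ, 0 ≤ ∫ s in (0 : ℝ)..t, (t - s) ^ (-α) * d s := fun t ht =>
    intervalIntegral.integral_nonneg ht.1 fun s hs =>
      mul_nonneg (Real.rpow_nonneg (sub_nonneg.2 hs.2) _) (hd0 s ⟨hs.1, hs.2.trans ht.2⟩)
  have hle' : ∀ t ∈ Icc 0 τ, d t ≤ M' * ∫ s in (0 : ℝ)..t, (t - s) ^ (-α) * d s := fun t ht =>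
    (hle t ht).trans (mul_le_mul_of_nonneg_right (le_max_left _ _) (hInonneg t ht))
  -- the window length
  set δ : ℝ := ((1 - α) / (2 * M')) ^ (1 - α)⁻¹ with hδ
  have hδ0 : 0 < δ := Real.rpow_pos_of_pos (by positivity) _
  have hδpow : δ ^ (1 - α) = (1 - α) / (2 * M') := Real.rpow_inv_rpow (by positivity) hα1.ne'
  have hq : M' * (δ ^ (1 - α) / (1 - α)) = 1 / 2 := by
    rw [hδpow]; field_simp
  -- induction over the windows `[k δ, (k + 1) δ]`
  suffices key : ∀ k : ℕ, ∀ t ∈ Icc 0 τ, t ≤ k * δ → d t = 0 by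
    intro t ht
    obtain ⟨k, hk⟩ := exists_nat_ge (t / δ)
    exact key k t ht ((div_le_iff₀ hδ0).1 hk)
  intro k
  induction k with
  | zero =>
    intro t ht hle0
    rw [Nat.cast_zero, zero_mul] at hle0
    have ht0 : t = 0 := le_antisymm hle0 ht.1
    have h := hle' t ht
    rw [ht0, intervalIntegral.integral_same, mul_zero] at h
    exact le_antisymm (ht0 ▸ h) (hd0 t ht)
  | succ k ih =>
    intro t ht htk
    set t₁ : ℝ := k * δ with ht₁
    rcases le_or_gt t t₁ with h | h
    · exact ih t ht h
    -- the window `W = [t₁, min τ (t₁ + δ)]` is nonempty and compact; `d` attains its maximum on it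
    have ht₁0 : 0 ≤ t₁ := by positivity
    have htk' : t ≤ t₁ + δ := by
      calc t ≤ ((k + 1 : ℕ) : ℝ) * δ := htk
        _ = t₁ + δ := by push_cast; ring
    set W : Set ℝ := Icc t₁ (min τ (t₁ + δ)) with hW
    have hWsub : W ⊆ Icc 0 τ := fun s hs => ⟨ht₁0.trans hs.1, hs.2.trans (min_le_left _ _)⟩
    have htW : t ∈ W := ⟨h.le, le_min ht.2 htk'⟩
    obtain ⟨tm, htmW, htm⟩ := isCompact_Icc.exists_isMaxOn ⟨t, htW⟩ (hd.mono hWsub)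
    set S : ℝ := d tm with hS
    have hS0 : 0 ≤ S := hd0 tm (hWsub htmW)
    have hdS : ∀ s ∈ W, d s ≤ S := fun s hs => htm hs
    -- the estimate at the maximum point: `S ≤ S / 2`
    have htm0 : t₁ ≤ tm := htmW.1
    have htmτ : tm ∈ Icc 0 τ := hWsub htmW
    have hcont0 : ContinuousOn d (uIcc 0 t₁) := by
      rw [uIcc_of_le ht₁0]; exact hd.mono (Icc_subset_Icc_right (htm0.trans htmτ.2))
    have hcont1 : ContinuousOn d (uIcc t₁ tm) := by
      rw [uIcc_of_le htm0]; exact hd.mono (Icc_subset_Icc_left ht₁0 |>.trans (Icc_subset_Icc_right htmτ.2))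
    have hi0 := intervalIntegrable_sub_rpow_neg_mul hα tm hcont0
    have hi1 := intervalIntegrable_sub_rpow_neg_mul hα tm hcont1
    have hsplit : ∫ s in (0 : ℝ)..tm, (tm - s) ^ (-α) * d s =
        (∫ s in (0 : ℝ)..t₁, (tm - s) ^ (-α) * d s) + ∫ s in t₁..tm, (tm - s) ^ (-α) * d s :=
      (intervalIntegral.integral_add_adjacent_intervals hi0 hi1).symm
    have hzero : ∫ s in (0 : ℝ)..t₁, (tm - s) ^ (-α) * d s = 0 := by
      rw [intervalIntegral.integral_congr (g := fun _ => (0 : ℝ)) fun s hs => ?_]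
      · exact intervalIntegral.integral_zero
      · rw [uIcc_of_le ht₁0] at hs
        show (tm - s) ^ (-α) * d s = 0
        rw [ih s ⟨hs.1, hs.2.trans (htm0.trans htmτ.2)⟩ hs.2, mul_zero]
    have hwin : ∫ s in t₁..tm, (tm - s) ^ (-α) * d s ≤ S * (δ ^ (1 - α) / (1 - α)) := by
      calc ∫ s in t₁..tm, (tm - s) ^ (-α) * d s ≤ ∫ s in t₁..tm, (tm - s) ^ (-α) * S := by
            refine intervalIntegral.integral_mono_on htm0 hi1 ?_ fun s hs => ?_
            · exact (intervalIntegrable_sub_rpow_neg_mul hα tm continuousOn_const :)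
            · exact mul_le_mul_of_nonneg_left
                (hdS s ⟨hs.1, le_min (hs.2.trans htmτ.2) (hs.2.trans htmW.2 |>.trans (min_le_right _ _))⟩)
                (Real.rpow_nonneg (sub_nonneg.2 hs.2) _)
        _ = (tm - t₁) ^ (1 - α) / (1 - α) * S := by
            rw [intervalIntegral.integral_mul_const, integral_sub_rpow_neg hα t₁ tm]
        _ ≤ δ ^ (1 - α) / (1 - α) * S := by
            have h1 : tm - t₁ ≤ δ := by linarith [htmW.2.trans (min_le_right τ (t₁ + δ))]
            gcongr
        _ = S * (δ ^ (1 - α) / (1 - α)) := mul_comm _ _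
    have hSle : S ≤ S / 2 := by
      calc S ≤ M' * ∫ s in (0 : ℝ)..tm, (tm - s) ^ (-α) * d s := hle' tm htmτ
        _ ≤ M' * (S * (δ ^ (1 - α) / (1 - α))) := by
            rw [hsplit, hzero, zero_add]; exact mul_le_mul_of_nonneg_left hwin hM'0.le
        _ = S * (M' * (δ ^ (1 - α) / (1 - α))) := by ring
        _ = S / 2 := by rw [hq]; ring
    have hSz : S = 0 := le_antisymm (by linarith) hS0
    exact le_antisymm (hSz ▸ hdS t htW) (hd0 t ht)

end Literature.Analysis.ODE

end
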